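import Summits.NavierStokesRegularity.FluidComputer.PalasekTowerReforce
import Summits.NavierStokesRegularity.NavierStokesRegularity.Theses.PalasekTowerBreakdown

/-! # BC3 skeleton v2 for the crux `EpisodeBase` (= `EpisodeBaseG`, register v2.3′ QUIET + GLOBAL ANCHOR)

Two registered stubs and the kernel-checked composition concluding the ROUTE DECL BY NAME
(`Summit.NavierStokesRegularity.NavierStokesRegularity.Theses.PalasekTowerBreakdown.EpisodeBase`):

* `stub_host_preparation` — HOST PREPARATION (∃-form; = `RungG 0`): some pinned, rigid, quiet schedule on the
  wide-base rates carries a globally anchored registered stage at LEVEL 0;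
* `stub_first_episodeR` — the FIRST EPISODE IN RE-FORCING FORM (planner g17 OBJECTION, STATUS 2026-08-26 ≈ l.1832:
  the ∀S-with-S's-own-force form of v1 is the silent-tail trap at level 0, because `Pins`/`Rigid`/`Quiet` and a
  level-0 `Stage` do not read the force after `τ 0`): for EVERY registered level-0 host `s₀` of a pinned rigid quiet
  `S` there is SOME admissible window force `g` (Clay class, silent from `T`, `push_small`), equal to `S.f` on the
  slab `[0, τ 0]`, such that the re-forced schedule `S.reforce g …` is again pinned, rigid and quiet and carries a
  registered LEVEL-1 stage whose velocity agrees with `s₀` on `[0, τ 0]` — the prover CHOOSES the push after seeing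
  the host (Palasek's first episode is forced, Rem. 1.4).

v1 (planner g16, c9e75b33c1a07c32) had the composition conclude `EpisodeBaseG`; the skeleton checker wants the
Theses name (operator INBOX l.94). Cell `ns-blowup`, planner g17. -/

namespace Summit.NavierStokesRegularity.FluidComputer.PalasekTowerClayBridge.BirthEpisodeBaseG

open Set MeasureTheory Filter Topology Function Real
open scoped ENNReal ContDiff NNReal
open Literature.Analysis.FluidPDE

/-- the v2.3′ route margin: strain floors ∧ (GLOBAL anchor ∧ (rigidity ∧ core ledger)) -/
abbrev mG : Margins TowerRates.wide := Margins.routeG TowerRates.wide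

/-- Stub statement (HOST PREPARATION, ∃-form): verbatim v1. -/
def HostPreparation : Prop :=
  ∃ S : Schedule TowerRates.wide, S.Pins 8 (6 / 5) ∧ S.Rigid ∧ S.Quiet ∧
    Nonempty (Stage 1 TowerRates.wide S mG 0)

/-- Stub statement (FIRST EPISODE, RE-FORCING form): every registered level-0 host can be PUSHED to a registered
level-1 stage by some admissible window force agreeing with the schedule's force up to `τ 0`. -/
def FirstEpisodeR : Prop :=
  ∀ S : Schedule TowerRates.wide, S.Pins 8 (6 / 5) → S.Rigid → S.Quiet →
    ∀ s₀ : Stage 1 TowerRates.wide S mG 0,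
      ∃ (g : ℝ → EuclideanSpace ℝ (Fin 3) → EuclideanSpace ℝ (Fin 3))
        (h₁ : IsSmoothOnHalfSpace g) (h₂ : HasRapidSpaceTimeDecay g)
        (h₃ : ∀ t, S.T ≤ t → ∀ x, g t x = 0)
        (h₄ : ∀ k, ∀ t ∈ Icc (S.τ k) (S.τ (k + 1)), ∀ x, ‖g t x‖ ≤ S.c₄ * TowerRates.wide.Y k),
        (∀ t ∈ Icc 0 (S.τ 0), ∀ x, g t x = S.f t x) ∧
        (S.reforce g h₁ h₂ h₃ h₄).Pins 8 (6 / 5) ∧ (S.reforce g h₁ h₂ h₃ h₄).Rigid ∧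
        (S.reforce g h₁ h₂ h₃ h₄).Quiet ∧
        ∃ s₁ : Stage 1 TowerRates.wide (S.reforce g h₁ h₂ h₃ h₄) mG 1,
          ∀ t ∈ Icc 0 (S.τ 0), s₁.u t = s₀.u t

/-- registered stub: host preparation. -/
theorem stub_host_preparation : HostPreparation := by
  sorry

/-- registered stub: the first episode, re-forcing form. -/
theorem stub_first_episodeR : FirstEpisodeR := by
  sorry

/-- **The composition (kernel-checked): host preparation + re-forced first episode ⇒ the route's crux
`EpisodeBase` BY NAME** (take the host's schedule and level-0 stage, re-force, the level-1 stage of the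
re-forced schedule witnesses `EpisodeBaseG`). -/
theorem EpisodeBase_of : HostPreparation → FirstEpisodeR →
    Summit.NavierStokesRegularity.NavierStokesRegularity.Theses.PalasekTowerBreakdown.EpisodeBase := by
  rintro ⟨S, hP, hR, hQ, ⟨s₀⟩⟩ hF
  obtain ⟨g, h₁, h₂, h₃, h₄, -, hP', hR', hQ', s₁, -⟩ := hF S hP hR hQ s₀
  exact ⟨S.reforce g h₁ h₂ h₃ h₄, hP', hR', hQ', ⟨s₁⟩⟩

/-- The hypothesis-free skeleton line the checker registers (valiant conjb-2 pattern): the crux from the two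
stubs (carries the stubs' `sorry`s — decoration, not closure evidence). -/
theorem EpisodeBase_skeleton :
    Summit.NavierStokesRegularity.NavierStokesRegularity.Theses.PalasekTowerBreakdown.EpisodeBase :=
  EpisodeBase_of stub_host_preparation stub_first_episodeR

end Summit.NavierStokesRegularity.FluidComputer.PalasekTowerClayBridge.BirthEpisodeBaseG
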